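import Summits.BirchSwinnertonDyer.BirchSwinnertonDyer.Theorems.ManinLocalTwoThreeSixteenSplitSupersingular
import Summits.BirchSwinnertonDyer.BirchSwinnertonDyer.Theorems.ManinLocalTwoThreeManinOddAtFourOfCore
import Summits.BirchSwinnertonDyer.BirchSwinnertonDyer.Theorems.ManinLocalTwoThreeSixteenExactDescends
import HarnessLib

/-!
# C2 READ ON THE CORE: {`16 ∣ N`} ∩ {`ord₂ j > 0`} ∩ {no dyadic twist is `2`-semistable} — the `χ₋₄` rotation preserves p2's CORE binder, so the
# LEAD's `16 ∣ N` reading composes with `maninOddAtFour_of_core`; skeleton v20 of `kato_shift_two` (route `ManinLocalTwoThree`, cell bsd-f2-manin;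
# crux C2 `ManinOddAtFour` stmt-BirchSwinnertonDyer-22967; LEAD seat p1 gen 13)

THE POINT.  p2 g14's `maninOddAtFour_of_core` (p705358) reduces the crux to its CORE: globally minimal `W`, lattice-optimal `D`, `4 ∣ N`,
`ord₂ j(W) > 0` AND `f₂(W ⊗ d) ≥ 2` for `d ∈ {−1, 2, −2}` (no dyadic twist of `W` is semistable at `2`; the complement is closed by print + the dyadic
untwist transport).  Both binders are stable under the `χ₋₄` rotation of the `16 ∣ N` reading and under the `u = 1` change to the `a₁ = a₃ = 0` model:
`j` by `variableChange_j` / `j_quadraticTwist` (`…SixteenSplitSupersingular`), the core by `quadraticTwist_smul` + `conductorExponent_smul'`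
(`twistCore_smul`) and `(W ⊗ (−1)) ⊗ {−1, 2, −2} ≅ {W, W ⊗ (−2), W ⊗ 2}` (`twistCore_negOneTwist`, with `f₂(W) ≥ 2` from `4 ∣ N`).  Hence
`maninOddAtFourCore_of_maninOddAtSixteenCore` and, through the by-locus level-wise composition with both binders threaded
(`not_two_dvd_maninConstant_of_levelLaws_blindGuard_core`), **`maninOddAtFour_of_katoFact_of_levelSixteenCoreLaws_blindPeriodRecut`** = the
composition of skeleton v20: the ROUTE DECL BY NAME from {F♯, F★, hex, F-es-21♭K} and the three laws READ ON THE CORE AT `16 ∣ N` — E-an-48 / E-an-53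
at data with a non-blind rational 2-torsion point, Kato–Néron integrality at the `X₁(N)`-optimal curve of totally blind classes off the period-dominated
locus (at `16 ∥ N` the core is the Kodaira rows II/4, I₀*/8, I₂*/10, I₃*/11 at `2`, p2/p3).  v19's stub 6♭ss implies v20's 6♭core by dropping
the core conjunct of the guard (one line; not recorded as a theorem here for the 400-line cap).

HONEST FRAMING.  A CONDITIONAL reduction and a re-indexing; the four facts are statement-only Literature readings; the three laws are OPEN (now on the
core only).  C2, Manin's conjecture, Stevens' conjecture and BSD are NOT proved.  No definitions, no sorry, axioms standard.
-/

set_option autoImplicit false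
-- lint-debt: the directory name repeats the summit name (sibling precedent `ManinLocalTwoThreeGammaOneKatoRoad.lean`)
set_option linter.dupNamespace false

noncomputable section

open scoped Classical MatrixGroups ModularForm NumberField
open PowerSeries CongruenceSubgroup IsDedekindDomain IsDedekindDomain.HeightOneSpectrum Rat.HeightOneSpectrum
open WeierstrassCurve Literature.NumberTheory.DiophantineGeometry Literature.NumberTheory.EllipticCurves
  Literature.NumberTheory.EllipticCurves.ModularForms Literature.RingTheory.FormalGroups
open Summit.BirchSwinnertonDyer.Rank1Residual.ManinAdditive
open Summit.BirchSwinnertonDyer.Rank1Residual.ManinAdditive.CuspidalKummer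
open Summit.BirchSwinnertonDyer.Rank1Residual.ManinAdditive.ShimuraLedger
open Summit.BirchSwinnertonDyer.Rank1Residual.ManinAdditive.KatoCurve

namespace Summit.BirchSwinnertonDyer.BirchSwinnertonDyer.Theorems.ManinLocalTwoThree

/-! ## §1 The CORE binder is an isomorphism invariant and survives the `χ₋₄` rotation -/

/-- `4 ∣ N(W) ⟹ f₂(W) ≥ 2` (the conductor norm's factorisation at `2` is the conductor exponent at the place above `2`). [folklore] -/
theorem two_le_conductorExponent_two_of_four_dvd_conductorNorm (W : WeierstrassCurve ℚ) [W.IsElliptic]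
    (h4 : 2 ^ 2 ∣ W.conductorNorm ℤ) :
    2 ≤ W.conductorExponent ((primesEquiv (R := ℤ)).symm ⟨2, Nat.prime_two⟩) := by
  set v : HeightOneSpectrum ℤ := (primesEquiv (R := ℤ)).symm ⟨2, Nat.prime_two⟩ with hvdef
  have hv : natGenerator v = 2 := congrArg Subtype.val ((primesEquiv (R := ℤ)).apply_symm_apply ⟨2, Nat.prime_two⟩)
  have hfac : (W.conductorNorm ℤ).factorization 2 = W.conductorExponent v := by
    rw [← hv]; exact W.factorization_conductorNorm_holds v
  have hN0 : W.conductorNorm ℤ ≠ 0 := (W.conductorNorm_pos_holds).ne'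
  rw [← hfac]
  exact (Nat.prime_two.pow_dvd_iff_le_factorization hN0).mp h4

/-- **The core binder is an isomorphism invariant**: `(C • W) ⊗ d ≅ W ⊗ d` (`quadraticTwist_smul`), `f₂` is an isomorphism invariant
(`conductorExponent_smul'`). [cite: SilvermanAEC2009, X.5 Cor. 5.4] -/
theorem twistCore_smul (W : WeierstrassCurve ℚ) [W.IsElliptic] (C : VariableChange ℚ)
    (hcore : ∀ d : ℤ, d = -1 ∨ d = 2 ∨ d = -2 →
      2 ≤ (W.quadraticTwist (d : ℚ)).conductorExponent ((primesEquiv (R := ℤ)).symm ⟨2, Nat.prime_two⟩)) :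
    ∀ d : ℤ, d = -1 ∨ d = 2 ∨ d = -2 →
      2 ≤ ((C • W).quadraticTwist (d : ℚ)).conductorExponent ((primesEquiv (R := ℤ)).symm ⟨2, Nat.prime_two⟩) := by
  intro d hd
  have hd0 : (d : ℚ) ≠ 0 := by rcases hd with rfl | rfl | rfl <;> norm_num
  haveI := W.isElliptic_quadraticTwist hd0
  rw [quadraticTwist_smul, conductorExponent_smul']
  exact hcore d hd

/-- **The core binder survives the `χ₋₄` twist** (`4 ∣ N(W)`): `(W ⊗ (−1)) ⊗ (−1) ≅ W` has `f₂ ≥ 2`, `(W ⊗ (−1)) ⊗ 2 = W ⊗ (−2)`,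
`(W ⊗ (−1)) ⊗ (−2) = W ⊗ 2`. [cite: SilvermanAEC2009, X.5 Cor. 5.4] -/
theorem twistCore_negOneTwist (W : WeierstrassCurve ℚ) [W.IsElliptic] (h4 : 2 ^ 2 ∣ W.conductorNorm ℤ)
    (hcore : ∀ d : ℤ, d = -1 ∨ d = 2 ∨ d = -2 →
      2 ≤ (W.quadraticTwist (d : ℚ)).conductorExponent ((primesEquiv (R := ℤ)).symm ⟨2, Nat.prime_two⟩)) :
    ∀ d : ℤ, d = -1 ∨ d = 2 ∨ d = -2 →
      2 ≤ ((W.quadraticTwist ((-1 : ℤ) : ℚ)).quadraticTwist (d : ℚ)).conductorExponent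
        ((primesEquiv (R := ℤ)).symm ⟨2, Nat.prime_two⟩) := by
  intro d hd
  rcases hd with rfl | rfl | rfl
  · rw [conductorExponent_quadraticTwist_quadraticTwist_self W _ (by norm_num : ((-1 : ℤ) : ℚ) ≠ 0)]
    exact two_le_conductorExponent_two_of_four_dvd_conductorNorm W h4
  · have e : (W.quadraticTwist ((-1 : ℤ) : ℚ)).quadraticTwist ((2 : ℤ) : ℚ) = W.quadraticTwist ((-2 : ℤ) : ℚ) := by
      rw [WeierstrassCurve.quadraticTwist_quadraticTwist]; norm_num
    rw [e]; exact hcore (-2) (Or.inr (Or.inr rfl))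
  · have e : (W.quadraticTwist ((-1 : ℤ) : ℚ)).quadraticTwist ((-2 : ℤ) : ℚ) = W.quadraticTwist ((2 : ℤ) : ℚ) := by
      rw [WeierstrassCurve.quadraticTwist_quadraticTwist]; norm_num
    rw [e]; exact hcore 2 (Or.inr (Or.inl rfl))

/-! ## §2 an's general optimal partner with the MODEL exposed (`W′ = C • (W ⊗ (−1))`) -/

/-- **GENERAL OPTIMAL PARTNER, model exposed** — an's `exists_optimalPartner_general` (B5b) re-proved VERBATIM with the extra output
`∃ C, C • (W ⊗ (−1)) = W′` (the partner IS the minimal model of the twist), from which `j` and the core binder transport.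
[cite: Pal2012, Lemma 3.1 and Prop. 2.4] [cite: Stevens1989, Lemma (5.4) p. 97] -/
theorem exists_optimalPartner_general_model (hnf : exists_isNewformOf)
    (W : WeierstrassCurve ℚ) [W.IsElliptic] [W.IsGloballyMinimal] [NeZero (W.conductorNorm ℤ)]
    (D : ModularParametrizationData W (W.conductorNorm ℤ)) (hD : IsLatticeOptimal D)
    (h4 : 2 ^ 2 ∣ W.conductorNorm ℤ) (m : ℕ) (hm4 : m ∣ 4) (h16 : 4 ^ 2 ∣ m * W.conductorNorm ℤ)
    (hNT0 : (haveI := W.isElliptic_quadraticTwist (show ((-1 : ℤ) : ℚ) ≠ 0 by norm_num);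
      (W.quadraticTwist ((-1 : ℤ) : ℚ)).conductorNorm ℤ) = m * W.conductorNorm ℤ) :
    ∃ (W' : WeierstrassCurve ℚ) (_ : W'.IsElliptic) (_ : W'.IsGloballyMinimal)
      (_ : NeZero (W'.conductorNorm ℤ)) (D' : ModularParametrizationData W' (W'.conductorNorm ℤ)),
      IsLatticeOptimal D' ∧ W'.conductorNorm ℤ = m * W.conductorNorm ℤ ∧ D'.c = D.c ∧
      ∃ C : VariableChange ℚ, C • W.quadraticTwist ((-1 : ℤ) : ℚ) = W' := by
  have hm0 : m ≠ 0 := by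
    rintro rfl; exact absurd (zero_dvd_iff.mp hm4) (by norm_num)
  have hd0 : ((-1 : ℤ) : ℚ) ≠ 0 := by norm_num
  haveI := W.isElliptic_quadraticTwist hd0
  set T := W.quadraticTwist ((-1 : ℤ) : ℚ) with hT
  have hNT : T.conductorNorm ℤ = m * W.conductorNorm ℤ := hNT0
  obtain ⟨C, hmin⟩ := hasGlobalMinimalModel_rat_holds T
  haveI := hmin
  have hNW' : (C • T).conductorNorm ℤ = m * W.conductorNorm ℤ := by
    rw [WeierstrassCurve.conductorNorm_smul]; exact hNT
  haveI : NeZero ((C • T).conductorNorm ℤ) :=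
    ⟨by rw [hNW']; exact mul_ne_zero hm0 (NeZero.ne _)⟩
  have hM'' : 4 ^ 2 ∣ (C • T).conductorNorm ℤ := by rw [hNW']; exact h16
  have h4' : 2 ^ 2 ∣ (C • T).conductorNorm ℤ := dvd_trans ⟨4, by norm_num⟩ hM''
  have hNdvd : W.conductorNorm ℤ ∣ (C • T).conductorNorm ℤ := by rw [hNW']; exact Dvd.intro_left m rfl
  have hL : (C • T).conductorNorm ℤ ∣ 4 * W.conductorNorm ℤ := by
    obtain ⟨k, hk⟩ := hm4
    rw [hNW', hk]
    exact ⟨k, by ring⟩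
  have hΔ : (C • T).Δ = W.Δ := negOneTwistMinimalDiscrEq_holds W (C • T) C h4 h4' rfl
  have hu2 : ((C.u : ℚ)) ^ 2 = 1 :=
    u_sq_eq_one_of_smul_quadraticTwist_of_Δ hd0 C rfl (by rw [hΔ]; norm_num)
  have hu1 : (C.u : ℚ) = 1 ∨ (C.u : ℚ) = -1 := mul_self_eq_one_iff.mp (by rw [← pow_two]; exact hu2)
  obtain ⟨g, hg⟩ := hnf (C • T)
  have hisoT : IsIsogenous T (C • T) := isIsogenous_smul T C
  obtain ⟨h₁, h₂⟩ := half_gaussSum_χ₄_twoSided_general D g hg h4 hM'' hNdvd hL hisoT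
  set s : ℂ := gaussSum (ZMod.χ₄.ringHomComp (Int.castRingHom ℂ)) (ZMod.stdAddChar (N := 4)) / 2
    with hs
  have hs2 : s ^ 2 = -1 := by
    rw [hs, div_pow, gaussSum_χ₄_ringHomComp_sq]; norm_num
  have hs0 : s ≠ 0 := fun h ↦ by rw [h] at hs2; norm_num at hs2
  have hs2' : s ^ 2 = ((((-1 : ℤ) : ℚ)) : ℂ) := by rw [hs2]; norm_num
  have hLT : IsNeronLatticeOf (T.baseChange ℂ) (D.L.mulLeft s⁻¹ (inv_ne_zero hs0)) :=
    isNeronLatticeOf_quadraticTwist_of_sq_eq ((-1 : ℤ) : ℚ) D.isNeronLattice hs0 hs2'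
  haveI : ((C • T).baseChange ℂ).IsElliptic := by rw [WeierstrassCurve.baseChange]; infer_instance
  obtain ⟨L', hL'⟩ := exists_isNeronLatticeOf_holds ((C • T).baseChange ℂ)
  have hlat := IsNeronLatticeOf.lattice_eq_mulLeft_of_smul C hLT hL'
  have huC0 : ((C.u : ℚ) : ℂ) ≠ 0 := by exact_mod_cast C.u.ne_zero
  have hmem : ∀ z : ℂ, z ∈ L'.lattice ↔ s * ((((C.u : ℚ) : ℂ))⁻¹ * z) ∈ D.L.lattice := fun z ↦ by
    rw [hlat, PeriodPair.mem_mulLeft_lattice, PeriodPair.mem_mulLeft_lattice, inv_inv]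
  have hεW : ∀ x : ℂ, (((C.u : ℚ) : ℂ))⁻¹ * x ∈ D.L.lattice ↔ x ∈ D.L.lattice := fun x ↦ by
    rcases hu1 with h | h <;> simp [h, neg_mem_iff]
  have hc0 : D.c ≠ 0 := D.maninConstant_ne_zero_holds
  have hc : ∀ z ∈ periodLattice g, (D.c : ℂ) * z ∈ L'.lattice := fun z hz ↦ by
    rw [hmem, ← mul_assoc, mul_comm s, mul_assoc, hεW, ← mul_assoc, mul_comm s, mul_assoc]
    · exact D.smul_periodLattice_le _ (h₁ z hz)
  obtain ⟨D', hf', hL'eq, hc'⟩ :=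
    PlusEtaManinInput.exists_modularParametrizationData_eq_of_smul_periodLattice_le hg hL' hc0 hc
  subst hf' hL'eq
  refine ⟨C • T, inferInstance, hmin, inferInstance, D', ?_, hNW', hc', C, rfl⟩
  intro z hz
  rw [hmem, ← mul_assoc, mul_comm s, mul_assoc, hεW] at hz
  obtain ⟨w₀, hw₀, hzw⟩ := hD _ hz
  refine ⟨-(s * w₀), neg_mem (h₂ w₀ hw₀), ?_⟩
  rw [hc']
  have hz' : z = -(s * (s * z)) := by
    rw [← mul_assoc, ← pow_two, hs2]; ring
  rw [hz', hzw]; ring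

/-! ## §3 The rotation with both binders: C2 on the core ⟸ C2 on the core ∩ {`16 ∣ N`} -/

/-- **Conductor level: the `4 ∣ N` core ⟸ the `16 ∣ N` core** (`j` and the core binder ride along the model `W′ = C • (W ⊗ (−1))` of §2:
`variableChange_j` + `j_quadraticTwist`, `twistCore_smul` + `twistCore_negOneTwist`). [cite: Pal2012, Lemma 3.1 and Prop. 2.4] -/
theorem two_not_dvd_c_of_four_dvd_of_sixteen_dvd_stratum_core (hnf : exists_isNewformOf)
    (h16 : ∀ (W' : WeierstrassCurve ℚ) [W'.IsElliptic] [W'.IsGloballyMinimal] [NeZero (W'.conductorNorm ℤ)]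
      (D' : ModularParametrizationData W' (W'.conductorNorm ℤ)),
      IsLatticeOptimal D' → 2 ^ 4 ∣ W'.conductorNorm ℤ →
      ((primesEquiv (R := 𝓞 ℚ)).symm ⟨2, Nat.prime_two⟩).valuation ℚ W'.j < 1 →
      (∀ d : ℤ, d = -1 ∨ d = 2 ∨ d = -2 → 2 ≤ (W'.quadraticTwist (d : ℚ)).conductorExponent ((primesEquiv (R := ℤ)).symm ⟨2, Nat.prime_two⟩)) → ¬ (2 : ℤ) ∣ D'.c)
    (W : WeierstrassCurve ℚ) [W.IsElliptic] [W.IsGloballyMinimal] [NeZero (W.conductorNorm ℤ)]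
    (D : ModularParametrizationData W (W.conductorNorm ℤ)) (hD : IsLatticeOptimal D)
    (h4 : 2 ^ 2 ∣ W.conductorNorm ℤ)
    (hss : ((primesEquiv (R := 𝓞 ℚ)).symm ⟨2, Nat.prime_two⟩).valuation ℚ W.j < 1)
    (hcore : (∀ d : ℤ, d = -1 ∨ d = 2 ∨ d = -2 → 2 ≤ (W.quadraticTwist (d : ℚ)).conductorExponent ((primesEquiv (R := ℤ)).symm ⟨2, Nat.prime_two⟩))) : ¬ (2 : ℤ) ∣ D.c := by
  by_cases h16W : 2 ^ 4 ∣ W.conductorNorm ℤ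
  · exact h16 W D hD h16W hss hcore
  have hd0 : ((-1 : ℤ) : ℚ) ≠ 0 := by norm_num
  haveI := W.isElliptic_quadraticTwist hd0
  have hcoreT := twistCore_negOneTwist W h4 hcore
  -- the multiplier `m ∈ {2, 4}` and the partner
  have hpartner : ∀ (m : ℕ), m ∣ 4 → 4 ^ 2 ∣ m * W.conductorNorm ℤ →
      (W.quadraticTwist ((-1 : ℤ) : ℚ)).conductorNorm ℤ = m * W.conductorNorm ℤ → ¬ (2 : ℤ) ∣ D.c := by
    intro m hm4 h16m hNT
    obtain ⟨W', i1, i2, i3, D', hD', hN', hc', C, hCW'⟩ := exists_optimalPartner_general_model hnf W D hD h4 m hm4 h16m hNT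
    subst hCW'
    have h16' : 2 ^ 4 ∣ (C • W.quadraticTwist ((-1 : ℤ) : ℚ)).conductorNorm ℤ := by rw [hN']; simpa using h16m
    have hj' : (C • W.quadraticTwist ((-1 : ℤ) : ℚ)).j = W.j := by rw [variableChange_j]; exact W.j_quadraticTwist hd0
    have hcore' := twistCore_smul _ C hcoreT
    rw [← hc']
    exact h16 _ D' hD' h16' (by rw [hj']; exact hss) hcore'
  by_cases h8 : 2 ^ 3 ∣ W.conductorNorm ℤ
  · exact hpartner 2 ⟨2, rfl⟩ (by obtain ⟨k, hk⟩ := h8; exact ⟨k, by rw [hk]; ring⟩)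
      (by push_cast; exact negOneTwistConductorTwoMul_holds W h8 h16W)
  · exact hpartner 4 dvd_rfl (by obtain ⟨k, hk⟩ := h4; exact ⟨k, by push_cast; rw [hk]; ring⟩)
      (by push_cast; exact negOneTwistConductorFourMul_holds W h4 h8)

/-- **C2 on the core ⟸ its `16 ∣ N` stratum** (level pinned to the conductor, then §3). [cite: DiamondShurman2005, Thm. 8.8.3 (modularity binder)] -/
theorem maninOddAtFourCore_of_maninOddAtSixteenCore
    (h16 : mazur_not_dvd_maninConstant_of_odd → abbesUllmo_not_dvd_maninConstant_of_not_dvd_level →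
      cesnavicius_not_two_dvd_maninConstant_of_two_dvd_level → exists_isNewformOf →
      ∀ (W : WeierstrassCurve ℚ) [W.IsElliptic] [W.IsGloballyMinimal] {N : ℕ} [NeZero N] (D : ModularParametrizationData W N),
        (∀ z ∈ D.L.lattice, ∃ w ∈ periodLattice D.f, z = D.c * w) → 2 ^ 4 ∣ N →
        ((primesEquiv (R := 𝓞 ℚ)).symm ⟨2, Nat.prime_two⟩).valuation ℚ W.j < 1 →
        (∀ d : ℤ, d = -1 ∨ d = 2 ∨ d = -2 → 2 ≤ (W.quadraticTwist (d : ℚ)).conductorExponent ((primesEquiv (R := ℤ)).symm ⟨2, Nat.prime_two⟩)) →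
        ¬ (2 : ℤ) ∣ D.maninConstant) :
    mazur_not_dvd_maninConstant_of_odd → abbesUllmo_not_dvd_maninConstant_of_not_dvd_level →
      cesnavicius_not_two_dvd_maninConstant_of_two_dvd_level → exists_isNewformOf →
      ∀ (W : WeierstrassCurve ℚ) [W.IsElliptic] [W.IsGloballyMinimal] {N : ℕ} [NeZero N] (D : ModularParametrizationData W N),
        (∀ z ∈ D.L.lattice, ∃ w ∈ periodLattice D.f, z = D.c * w) → 2 ^ 2 ∣ N →
        ((primesEquiv (R := 𝓞 ℚ)).symm ⟨2, Nat.prime_two⟩).valuation ℚ W.j < 1 →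
        (∀ d : ℤ, d = -1 ∨ d = 2 ∨ d = -2 → 2 ≤ (W.quadraticTwist (d : ℚ)).conductorExponent ((primesEquiv (R := ℤ)).symm ⟨2, Nat.prime_two⟩)) →
        ¬ (2 : ℤ) ∣ D.maninConstant := by
  intro hMz hAU hCs hnf W _ _ N _ D hD h4 hss hcore
  haveI : NeZero (W.conductorNorm ℤ) := ⟨(W.conductorNorm_pos_holds).ne'⟩
  obtain ⟨g, hg⟩ := hnf W
  have hN : N = W.conductorNorm ℤ := IsNewformOf.level_eq_level D.isNewformOf hg
  subst hN
  refine two_not_dvd_c_of_four_dvd_of_sixteen_dvd_stratum_core hnf ?_ W D hD h4 hss hcore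
  intro W' _ _ _ D' hD' h16' hss' hcore'
  exact h16 hMz hAU hCs hnf W' D' hD' h16' hss' hcore'

/-! ## §4 The by-locus level-wise composition with both binders threaded -/

/-- **C2 LEVEL-WISE on the core, the Kato law blind-guarded** — `not_two_dvd_maninConstant_of_levelLaws_blindGuard_ss` with the core binder carried
to every law instance (`twistCore_smul` for the `a₁ = a₃ = 0` model `C • W`; the guard names that model).  Irreducible `W[2]`: F♯ via the Γ₁ road.
CONDITIONAL reduction; nothing about BSD or Manin's conjecture is proved.
[cite: Kato2004Asterisque, Thm. 12.5 (1) (p. 221) (F♯)] [cite: ConradEdixhovenStein2003, §6.1.2 and §6.2 (F★)] [cite: Stevens1989, §2] -/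
theorem not_two_dvd_maninConstant_of_levelLaws_blindGuard_core
    (hF : kato_neron_isIntegral_twistedSymbolSum_of_additive_two_real)
    (hFstar : optimalGamma1Parametrization_cusp_rational) (hex : exists_optimal_gamma1ParametrizationData)
    {N : ℕ} [NeZero N] (h4 : 2 ^ 2 ∣ N)
    (h48N : ∀ (V : WeierstrassCurve ℚ) [V.IsElliptic] [V.IsGloballyMinimal] (D : ModularParametrizationData V N)
      (a : ℕ → ℤ), (∀ n, (a n : ℂ) = cuspCoeff D.f n) →
      (∀ z ∈ D.L.lattice, ∃ w ∈ periodLattice D.f, z = D.c * w) →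
      ((primesEquiv (R := 𝓞 ℚ)).symm ⟨2, Nat.prime_two⟩).valuation ℚ V.j < 1 → (∀ d : ℤ, d = -1 ∨ d = 2 ∨ d = -2 → 2 ≤ (V.quadraticTwist (d : ℚ)).conductorExponent ((primesEquiv (R := ℤ)).symm ⟨2, Nat.prime_two⟩)) →
      ∀ e : ℚ, V.twoTorsionPolynomial.toPoly.IsRoot e → ∀ z : ℚ⟦X⟧, IsParamGerm V D.c a z →
      ∃ (r : ℕ → ℤ) (g A B : ℤ⟦X⟧), IsCuspidalKummerRep N (kummerSeries V D.c e z) r g A B)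
    (h53N : ∀ (V : WeierstrassCurve ℚ) [V.IsElliptic] [V.IsGloballyMinimal] (D : ModularParametrizationData V N)
      (a : ℕ → ℤ), (∀ n, (a n : ℂ) = cuspCoeff D.f n) →
      (∀ z ∈ D.L.lattice, ∃ w ∈ periodLattice D.f, z = D.c * w) →
      ((primesEquiv (R := 𝓞 ℚ)).symm ⟨2, Nat.prime_two⟩).valuation ℚ V.j < 1 → (∀ d : ℤ, d = -1 ∨ d = 2 ∨ d = -2 → 2 ≤ (V.quadraticTwist (d : ℚ)).conductorExponent ((primesEquiv (R := ℤ)).symm ⟨2, Nat.prime_two⟩)) →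
      ∀ (a₂ a₄ e : ℤ), V.a₁ = 0 → V.a₃ = 0 → V.a₂ = a₂ → V.a₄ = a₄ →
      V.twoTorsionPolynomial.toPoly.IsRoot (e : ℚ) → ¬ KummerBlindAtTwo a₂ a₄ e →
      ∀ z : ℚ⟦X⟧, IsParamGerm V D.c a z →
      ∀ (r : ℕ → ℤ) (g A B : ℤ⟦X⟧), IsCuspidalKummerRep N (kummerSeries V D.c ((e : ℚ)) z) r g A B →
      ∃ δ ∈ N.divisors, Odd (r δ))
    (hKatoN : ∀ (V : WeierstrassCurve ℚ) [V.IsElliptic] [V.IsGloballyMinimal] (D₁ : Gamma1ParametrizationData V N),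
      D₁.IsOptimal → (∃ (W₀ : WeierstrassCurve ℚ) (_ : W₀.IsElliptic) (_ : W₀.IsGloballyMinimal) (D₀ : ModularParametrizationData W₀ N),
        IsIsogenous V W₀ ∧ (∀ z ∈ D₀.L.lattice, ∃ w ∈ periodLattice D₀.f, z = D₀.c * w) ∧
        W₀.a₁ = 0 ∧ W₀.a₃ = 0 ∧ HasRationalTwoTorsion W₀ ∧ AllRationalTwoTorsionBlind W₀ ∧
        ((primesEquiv (R := 𝓞 ℚ)).symm ⟨2, Nat.prime_two⟩).valuation ℚ W₀.j < 1 ∧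
        (∀ d : ℤ, d = -1 ∨ d = 2 ∨ d = -2 → 2 ≤ (W₀.quadraticTwist (d : ℚ)).conductorExponent ((primesEquiv (R := ℤ)).symm ⟨2, Nat.prime_two⟩))) → KatoFactTwoAt V D₁.f)
    (W : WeierstrassCurve ℚ) [W.IsElliptic] [W.IsGloballyMinimal] (D : ModularParametrizationData W N)
    (hopt : ∀ z ∈ D.L.lattice, ∃ w ∈ periodLattice D.f, z = D.c * w)
    (hss : ((primesEquiv (R := 𝓞 ℚ)).symm ⟨2, Nat.prime_two⟩).valuation ℚ W.j < 1) (hcore : (∀ d : ℤ, d = -1 ∨ d = 2 ∨ d = -2 → 2 ≤ (W.quadraticTwist (d : ℚ)).conductorExponent ((primesEquiv (R := ℤ)).symm ⟨2, Nat.prime_two⟩))) :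
    ¬ (2 : ℤ) ∣ D.maninConstant := by
  by_cases hirr : W.HasIrreducibleModPGaloisRep 2
  · exact katoManinOddTwo_of_real_of_exists_gamma1 hF hex W D hopt h4 hirr
  have h4' : 4 ∣ N := by norm_num at h4; exact h4
  obtain ⟨h2, hN2⟩ := lFunction_two_eq_zero_of_four_dvd W D.isNewformOf h4'
  have hadd := hasAdditiveReductionAt_two_of_lFunction_two_eq_zero W h2 hN2
  obtain ⟨C, M, hu, hCW, hM1, hM3, hmin⟩ := exists_smul_eq_map_a₁_a₃_eq_zero_of_hasAdditiveReductionAt_two W hadd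
  haveI := hmin
  obtain ⟨D', hf, hc, hL, -⟩ := exists_modularParametrizationData_smul_of_u_eq_one W D C hu
  have hopt' : ∀ z ∈ D'.L.lattice, ∃ w ∈ periodLattice D'.f, z = D'.c * w := by
    rw [hL, hf, hc]; exact hopt
  have ha₁ : (C • W).a₁ = 0 := by rw [hCW, map_a₁, hM1, map_zero]
  have ha₃ : (C • W).a₃ = 0 := by rw [hCW, map_a₃, hM3, map_zero]
  have hssC : ((primesEquiv (R := 𝓞 ℚ)).symm ⟨2, Nat.prime_two⟩).valuation ℚ (C • W).j < 1 := by
    rw [variableChange_j]; exact hss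
  have hcoreC := twistCore_smul W C hcore
  suffices h : ¬ (2 : ℤ) ∣ D'.maninConstant by
    change ¬ (2 : ℤ) ∣ D'.c at h
    change ¬ (2 : ℤ) ∣ D.c
    rwa [hc] at h
  by_cases hnb : HasNonBlindRationalTwoTorsion (C • W)
  · exact not_two_dvd_maninConstant_of_cuspidalKummerAt_of_hasNonBlind (C • W) D' h4 ha₁ ha₃ hnb
      (fun a ha => h48N (C • W) D' a ha hopt' hssC hcoreC) (fun a ha => h53N (C • W) D' a ha hopt' hssC hcoreC)
  · have hall : AllRationalTwoTorsionBlind (C • W) := (allBlind_or_hasNonBlind (C • W)).resolve_right hnb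
    have hred' : ¬ (C • W).HasIrreducibleModPGaloisRep 2 := by
      rwa [Mazur1978.hasIrreducibleModPGaloisRep_smul_iff]
    obtain ⟨e, he⟩ := exists_isRoot_twoTorsionPolynomial_of_not_hasIrreducibleModPGaloisRep_two (C • W) hred'
    have hT : HasRationalTwoTorsion (C • W) := ⟨e, (isRoot_twoTorsionPolynomial_iff_of_a₁_a₃ (C • W) ha₁ ha₃ e).mp he⟩
    obtain ⟨W₁, i₁, i₂, D₁, hiso, hD₁⟩ := hex (C • W) D' hopt'
    have hK : KatoFactTwoAt W₁ D₁.f :=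
      hKatoN W₁ D₁ hD₁ ⟨C • W, inferInstance, hmin, D', hiso, hopt', ha₁, ha₃, hT, hall, hssC, hcoreC⟩
    exact not_two_dvd_maninConstant_of_katoFactAt₁_of_allBlind hFstar W₁ (C • W) D₁ D' hiso hD₁ hopt' h4 ha₁ ha₃ hall hK

/-! ## §5 The composition of skeleton v20: laws READ ON THE CORE at `16 ∣ N` -/

/-- **C2 on the core ∩ {`16 ∣ N`} ⟸ F♯ ∧ F★ ∧ hex ∧ F-es-21♭K ∧ the three laws READ THERE**, by §4 + the period-recut dispatcher.  CONDITIONAL.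
[cite: Kato2004Asterisque, Thm. 12.5 (1) (p. 221)] [cite: ConradEdixhovenStein2003, §6.1.2 and §6.2] [cite: Stevens1989, §2] -/
theorem maninOddAtSixteenCore_of_katoFact_of_levelSixteenCoreLaws_blindPeriodRecut
    (hF : kato_neron_isIntegral_twistedSymbolSum_of_additive_two_real)
    (hFstar : optimalGamma1Parametrization_cusp_rational) (hex : exists_optimal_gamma1ParametrizationData)
    (hK : kato_isIntegral_twistedSymbolSum_two_symbolClosure)
    (h48 : ∀ (W : WeierstrassCurve ℚ) [W.IsElliptic] [W.IsGloballyMinimal] {N : ℕ} [NeZero N]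
      (D : ModularParametrizationData W N) (a : ℕ → ℤ), (∀ n, (a n : ℂ) = cuspCoeff D.f n) →
      2 ^ 4 ∣ N → (∀ z ∈ D.L.lattice, ∃ w ∈ periodLattice D.f, z = D.c * w) →
      ((primesEquiv (R := 𝓞 ℚ)).symm ⟨2, Nat.prime_two⟩).valuation ℚ W.j < 1 →
      (∀ d : ℤ, d = -1 ∨ d = 2 ∨ d = -2 → 2 ≤ (W.quadraticTwist (d : ℚ)).conductorExponent ((primesEquiv (R := ℤ)).symm ⟨2, Nat.prime_two⟩)) →
      ∀ e : ℚ, W.twoTorsionPolynomial.toPoly.IsRoot e →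
      ∀ z : ℚ⟦X⟧, IsParamGerm W D.c a z →
      ∃ (r : ℕ → ℤ) (g A B : ℤ⟦X⟧), IsCuspidalKummerRep N (kummerSeries W D.c e z) r g A B)
    (h53 : ∀ (W : WeierstrassCurve ℚ) [W.IsElliptic] [W.IsGloballyMinimal] {N : ℕ} [NeZero N]
      (D : ModularParametrizationData W N) (a : ℕ → ℤ), (∀ n, (a n : ℂ) = cuspCoeff D.f n) →
      2 ^ 4 ∣ N → (∀ z ∈ D.L.lattice, ∃ w ∈ periodLattice D.f, z = D.c * w) →
      ((primesEquiv (R := 𝓞 ℚ)).symm ⟨2, Nat.prime_two⟩).valuation ℚ W.j < 1 →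
      (∀ d : ℤ, d = -1 ∨ d = 2 ∨ d = -2 → 2 ≤ (W.quadraticTwist (d : ℚ)).conductorExponent ((primesEquiv (R := ℤ)).symm ⟨2, Nat.prime_two⟩)) →
      ∀ (a₂ a₄ e : ℤ), W.a₁ = 0 → W.a₃ = 0 → W.a₂ = a₂ → W.a₄ = a₄ →
      W.twoTorsionPolynomial.toPoly.IsRoot (e : ℚ) → ¬ KummerBlindAtTwo a₂ a₄ e →
      ∀ z : ℚ⟦X⟧, IsParamGerm W D.c a z →
      ∀ (r : ℕ → ℤ) (g A B : ℤ⟦X⟧), IsCuspidalKummerRep N (kummerSeries W D.c ((e : ℚ)) z) r g A B →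
      ∃ δ ∈ N.divisors, Odd (r δ))
    (h110 : ∀ (V : WeierstrassCurve ℚ) [V.IsElliptic] [V.IsGloballyMinimal] {N : ℕ} [NeZero N]
      (D₁ : Gamma1ParametrizationData V N), D₁.IsOptimal → 2 ^ 4 ∣ N →
      (¬ ∃ (V' : WeierstrassCurve ℚ) (_ : V'.IsElliptic) (_ : V'.IsGloballyMinimal) (q m : ℤ),
        Odd q ∧ WeierstrassCurve.IsIsogenous V' V ∧ (q : ℝ) * V'.realPeriodRat = (m : ℝ) * V.realPeriodRat ∧
        IsSymbolClosureCurve V' D₁.f) →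
      (∃ (W₀ : WeierstrassCurve ℚ) (_ : W₀.IsElliptic) (_ : W₀.IsGloballyMinimal) (D₀ : ModularParametrizationData W₀ N),
        IsIsogenous V W₀ ∧ (∀ z ∈ D₀.L.lattice, ∃ w ∈ periodLattice D₀.f, z = D₀.c * w) ∧
        W₀.a₁ = 0 ∧ W₀.a₃ = 0 ∧ HasRationalTwoTorsion W₀ ∧ AllRationalTwoTorsionBlind W₀ ∧
        ((primesEquiv (R := 𝓞 ℚ)).symm ⟨2, Nat.prime_two⟩).valuation ℚ W₀.j < 1 ∧
        (∀ d : ℤ, d = -1 ∨ d = 2 ∨ d = -2 → 2 ≤ (W₀.quadraticTwist (d : ℚ)).conductorExponent ((primesEquiv (R := ℤ)).symm ⟨2, Nat.prime_two⟩))) →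
      KatoFactTwoAt V D₁.f)
    :
    mazur_not_dvd_maninConstant_of_odd → abbesUllmo_not_dvd_maninConstant_of_not_dvd_level →
      cesnavicius_not_two_dvd_maninConstant_of_two_dvd_level → exists_isNewformOf →
      ∀ (W : WeierstrassCurve ℚ) [W.IsElliptic] [W.IsGloballyMinimal] {N : ℕ} [NeZero N] (D : ModularParametrizationData W N),
        (∀ z ∈ D.L.lattice, ∃ w ∈ periodLattice D.f, z = D.c * w) → 2 ^ 4 ∣ N →
        ((primesEquiv (R := 𝓞 ℚ)).symm ⟨2, Nat.prime_two⟩).valuation ℚ W.j < 1 →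
        (∀ d : ℤ, d = -1 ∨ d = 2 ∨ d = -2 → 2 ≤ (W.quadraticTwist (d : ℚ)).conductorExponent ((primesEquiv (R := ℤ)).symm ⟨2, Nat.prime_two⟩)) →
        ¬ (2 : ℤ) ∣ D.maninConstant := by
  intro _hMz _hAU _hCs _hnf W _ _ N _ D hopt h16 hss hcore
  have h4 : 2 ^ 2 ∣ N := dvd_trans ⟨4, by norm_num⟩ h16
  exact not_two_dvd_maninConstant_of_levelLaws_blindGuard_core hF hFstar hex h4
    (fun V _ _ D' a ha hopt' hssV hcV => h48 V D' a ha h16 hopt' hssV hcV)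
    (fun V _ _ D' a ha hopt' hssV hcV => h53 V D' a ha h16 hopt' hssV hcV)
    (fun V _ _ D₁ hD₁ hguard =>
      katoFactTwoAt_of_symbolClosure_of_periodRecut hK h4 V D₁ (fun hno => h110 V D₁ hD₁ h16 hno hguard)) W D hopt hss hcore

/-- **THE ROUTE DECL `Theses.ManinLocalTwoThree.ManinOddAtFour` BY NAME from the seven inputs of skeleton v20** — the three laws READ ON THE CORE
{`16 ∣ N`} ∩ {`ord₂ j > 0`} ∩ {no dyadic twist `2`-semistable}: §5, then the binder-preserving rotation (§3) to the `4 ∣ N` core, then p2's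
`maninOddAtFour_of_core` (the complement of the core is closed by the crux's own printed-fact binders).  CONDITIONAL reduction = the composition
`ManinOddAtFour_of` of skeleton v20; C2, Manin's conjecture and BSD are NOT proved.
[cite: Kato2004Asterisque, Thm. 12.5 (1) (p. 221)] [cite: ConradEdixhovenStein2003, §6.1.2 and §6.2] [cite: Stevens1989, §2 and Lemmas (5.2), (5.4)]
[cite: Cesnavicius2018, Thm. 1.2] -/
theorem maninOddAtFour_of_katoFact_of_levelSixteenCoreLaws_blindPeriodRecut
    (hF : kato_neron_isIntegral_twistedSymbolSum_of_additive_two_real)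
    (hFstar : optimalGamma1Parametrization_cusp_rational) (hex : exists_optimal_gamma1ParametrizationData)
    (hK : kato_isIntegral_twistedSymbolSum_two_symbolClosure)
    (h48 : ∀ (W : WeierstrassCurve ℚ) [W.IsElliptic] [W.IsGloballyMinimal] {N : ℕ} [NeZero N]
      (D : ModularParametrizationData W N) (a : ℕ → ℤ), (∀ n, (a n : ℂ) = cuspCoeff D.f n) →
      2 ^ 4 ∣ N → (∀ z ∈ D.L.lattice, ∃ w ∈ periodLattice D.f, z = D.c * w) →
      ((primesEquiv (R := 𝓞 ℚ)).symm ⟨2, Nat.prime_two⟩).valuation ℚ W.j < 1 →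
      (∀ d : ℤ, d = -1 ∨ d = 2 ∨ d = -2 → 2 ≤ (W.quadraticTwist (d : ℚ)).conductorExponent ((primesEquiv (R := ℤ)).symm ⟨2, Nat.prime_two⟩)) →
      ∀ e : ℚ, W.twoTorsionPolynomial.toPoly.IsRoot e →
      ∀ z : ℚ⟦X⟧, IsParamGerm W D.c a z →
      ∃ (r : ℕ → ℤ) (g A B : ℤ⟦X⟧), IsCuspidalKummerRep N (kummerSeries W D.c e z) r g A B)
    (h53 : ∀ (W : WeierstrassCurve ℚ) [W.IsElliptic] [W.IsGloballyMinimal] {N : ℕ} [NeZero N]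
      (D : ModularParametrizationData W N) (a : ℕ → ℤ), (∀ n, (a n : ℂ) = cuspCoeff D.f n) →
      2 ^ 4 ∣ N → (∀ z ∈ D.L.lattice, ∃ w ∈ periodLattice D.f, z = D.c * w) →
      ((primesEquiv (R := 𝓞 ℚ)).symm ⟨2, Nat.prime_two⟩).valuation ℚ W.j < 1 →
      (∀ d : ℤ, d = -1 ∨ d = 2 ∨ d = -2 → 2 ≤ (W.quadraticTwist (d : ℚ)).conductorExponent ((primesEquiv (R := ℤ)).symm ⟨2, Nat.prime_two⟩)) →
      ∀ (a₂ a₄ e : ℤ), W.a₁ = 0 → W.a₃ = 0 → W.a₂ = a₂ → W.a₄ = a₄ →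
      W.twoTorsionPolynomial.toPoly.IsRoot (e : ℚ) → ¬ KummerBlindAtTwo a₂ a₄ e →
      ∀ z : ℚ⟦X⟧, IsParamGerm W D.c a z →
      ∀ (r : ℕ → ℤ) (g A B : ℤ⟦X⟧), IsCuspidalKummerRep N (kummerSeries W D.c ((e : ℚ)) z) r g A B →
      ∃ δ ∈ N.divisors, Odd (r δ))
    (h110 : ∀ (V : WeierstrassCurve ℚ) [V.IsElliptic] [V.IsGloballyMinimal] {N : ℕ} [NeZero N]
      (D₁ : Gamma1ParametrizationData V N), D₁.IsOptimal → 2 ^ 4 ∣ N →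
      (¬ ∃ (V' : WeierstrassCurve ℚ) (_ : V'.IsElliptic) (_ : V'.IsGloballyMinimal) (q m : ℤ),
        Odd q ∧ WeierstrassCurve.IsIsogenous V' V ∧ (q : ℝ) * V'.realPeriodRat = (m : ℝ) * V.realPeriodRat ∧
        IsSymbolClosureCurve V' D₁.f) →
      (∃ (W₀ : WeierstrassCurve ℚ) (_ : W₀.IsElliptic) (_ : W₀.IsGloballyMinimal) (D₀ : ModularParametrizationData W₀ N),
        IsIsogenous V W₀ ∧ (∀ z ∈ D₀.L.lattice, ∃ w ∈ periodLattice D₀.f, z = D₀.c * w) ∧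
        W₀.a₁ = 0 ∧ W₀.a₃ = 0 ∧ HasRationalTwoTorsion W₀ ∧ AllRationalTwoTorsionBlind W₀ ∧
        ((primesEquiv (R := 𝓞 ℚ)).symm ⟨2, Nat.prime_two⟩).valuation ℚ W₀.j < 1 ∧
        (∀ d : ℤ, d = -1 ∨ d = 2 ∨ d = -2 → 2 ≤ (W₀.quadraticTwist (d : ℚ)).conductorExponent ((primesEquiv (R := ℤ)).symm ⟨2, Nat.prime_two⟩))) →
      KatoFactTwoAt V D₁.f)
    : Summit.BirchSwinnertonDyer.BirchSwinnertonDyer.Theses.ManinLocalTwoThree.ManinOddAtFour :=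
  maninOddAtFour_of_core
    (maninOddAtFourCore_of_maninOddAtSixteenCore
      (maninOddAtSixteenCore_of_katoFact_of_levelSixteenCoreLaws_blindPeriodRecut hF hFstar hex hK h48 h53 h110))

end Summit.BirchSwinnertonDyer.BirchSwinnertonDyer.Theorems.ManinLocalTwoThree

end
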